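import Summits.AtomisticToContinuum.FouriersLaw.Theorems.PhononMeanFreePathDefs
import Summits.AtomisticToContinuum.FouriersLaw.Theorems.PhononMeanFreePathCoherentDephasingRightBalance

/-!
# Line `Sketch` of crux `PhononMeanFreePath.CoherentDephasing` (stmt-AtomisticToContinuum-11810): the total energy balance of the mean field

Fixed-`N` bookkeeping for the coherent (Gibbs-averaged) response field of the kick of the `(N+1)`-site chain
`pinnedChain ω₂ lam β γ` at temperature `T` (vocabulary `Theorems/PhononMeanFreePathDefs`, section CoherentField:
`m_x = momResp`, `n_x = posResp`, `c_x = cubeResp`, `d_b = stretchCubeResp`, `F_b = bondForceResp`).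

**`totalBalance_of_meanField`** (the card's `CoherentEnergyBalance`). Under the two fixed-`N` hypotheses of the line's
skeleton — the Duhamel (integrated Dynkin) equations
`n_x(t) = ∫₀ᵗ m_x`, `m_x(t) = T·[x = 0] + ∫₀ᵗ (-ω₂ n_x - lam c_x + Σ_b ([b = x] - [b+1 = x]) F_b - γ([x = 0] + [x = N]) m_x)`
for `t ≥ 0`, and the regularity package (continuity of `m, n, c, d`, linearity `F_b = (n_{b+1} - n_b) + β d_b`,
exponential decay `|m|,|n|,|c|,|d| ≤ C e^{-ct}` on `t ≥ 0`) — the TOTAL harmonic energy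
`E(t) = ½ Σ_x (m_x² + ω₂ n_x²) + ½ Σ_b (n_{b+1} - n_b)²` satisfies `E(0) = T²/2` (the kick), `E(∞) = 0`, and
`E' = -γ (m_0² + m_N²) - lam Σ_x m_x c_x - β Σ_b d_b (m_{b+1} - m_b)` on `(0, ∞)`; integrating,

  `γ (∫₀^∞ m_0² + ∫₀^∞ m_N²) + (lam Σ_x ∫₀^∞ m_x c_x + β Σ_b ∫₀^∞ d_b (m_{b+1} - m_b)) = T² / 2`.

For `N = 0` the single site carries both baths (`Fin.last 0 = 0`, friction `2γ`) and the identity reads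
`2γ ∫ m_0² + lam ∫ m_0 c_0 = T²/2`. Pure real analysis: FTC-1 for the Duhamel primitives
(`intervalIntegral.integral_hasDerivAt_right`), an abstract `Finset` identity for `E'` (`energyDeriv_eq`), FTC-2 on
`(0, ∞)` (`MeasureTheory.integral_Ioi_of_hasDerivAt_of_tendsto`) and domination by `e^{-ct}` (the helpers
`integrableOn_Ioi_of_abs_le_exp`, `tendsto_zero_of_abs_le_exp` of the sibling file `…CoherentDephasingRightBalance`,
which books the energy to the RIGHT of a bond in the same way). No chain facts are used.
-/

noncomputable section

open MeasureTheory Set Filter Topology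

namespace Summit.AtomisticToContinuum.FouriersLaw.Theorems.CoherentDephasing.TotalBalance

open Literature.MathematicalPhysics.KineticTheory.HeatConduction
open Summit.AtomisticToContinuum.FouriersLaw.Theorems.PhononMeanFreePath

section Algebra

variable {N : ℕ}

/-- `Σ_x g_x · [b = x] a = g_b a` (the bond force acts on its left site `b.castSucc`). [folklore] -/
theorem sum_mul_ite_val_eq_castSucc (b : Fin N) (g : Fin (N + 1) → ℝ) (a : ℝ) :
    ∑ x : Fin (N + 1), g x * (if (b : ℕ) = (x : ℕ) then a else 0) = g b.castSucc * a := by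
  rw [Finset.sum_eq_single b.castSucc]
  · simp
  · intro x _ hx
    have h : (b : ℕ) ≠ (x : ℕ) := fun h => hx (Fin.ext (by rw [Fin.val_castSucc]; exact h.symm))
    simp [h]
  · exact fun h => absurd (Finset.mem_univ _) h

/-- `Σ_x g_x · [b + 1 = x] a = g_{b+1} a` (the bond force acts on its right site `b.succ`). [folklore] -/
theorem sum_mul_ite_val_succ (b : Fin N) (g : Fin (N + 1) → ℝ) (a : ℝ) :
    ∑ x : Fin (N + 1), g x * (if (b : ℕ) + 1 = (x : ℕ) then a else 0) = g b.succ * a := by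
  rw [Finset.sum_eq_single b.succ]
  · simp
  · intro x _ hx
    have h : (b : ℕ) + 1 ≠ (x : ℕ) := fun h => hx (Fin.ext (by rw [Fin.val_succ]; exact h.symm))
    simp [h]
  · exact fun h => absurd (Finset.mem_univ _) h

/-- `Σ_x [x = 0] g_x = g_0` (left bath site). [folklore] -/
theorem sum_ite_val_zero_mul (g : Fin (N + 1) → ℝ) :
    ∑ x : Fin (N + 1), (if (x : ℕ) = 0 then (1 : ℝ) else 0) * g x = g 0 := by
  rw [Finset.sum_eq_single 0]
  · simp
  · intro x _ hx
    have h : (x : ℕ) ≠ 0 := fun h => hx (Fin.ext h)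
    simp [h]
  · exact fun h => absurd (Finset.mem_univ _) h

/-- `Σ_x [x = N] g_x = g_N` (right bath site `Fin.last N`). [folklore] -/
theorem sum_ite_val_last_mul (g : Fin (N + 1) → ℝ) :
    ∑ x : Fin (N + 1), (if (x : ℕ) = N then (1 : ℝ) else 0) * g x = g (Fin.last N) := by
  rw [Finset.sum_eq_single (Fin.last N)]
  · simp
  · intro x _ hx
    have h : (x : ℕ) ≠ N := fun h => hx (Fin.ext (by rw [Fin.val_last]; exact h))
    simp [h]
  · exact fun h => absurd (Finset.mem_univ _) h

/-- **The energy derivative identity** (abstract `Finset` algebra). For site values `m, n, c : Fin (N+1) → ℝ`, bond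
values `d, F : Fin N → ℝ` with `F_b = (n_{b+1} - n_b) + β d_b`, and the mean-field drift
`Φ_x = -ω₂ n_x - lam c_x + Σ_b ([b = x] - [b+1 = x]) F_b - γ ([x = 0] + [x = N]) m_x`:
`Σ_x (m_x Φ_x + ω₂ n_x m_x) + Σ_b (n_{b+1} - n_b)(m_{b+1} - m_b)
  = -(γ (m_0² + m_N²) + (lam Σ_x m_x c_x + β Σ_b d_b (m_{b+1} - m_b)))`
(the harmonic bond forces telescope against the bond energies; only the bath friction and the anharmonic work
survive). [folklore] -/
theorem energyDeriv_eq (ω₂ lam β γ : ℝ) (m n c Φ : Fin (N + 1) → ℝ) (d F : Fin N → ℝ)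
    (hF : ∀ b, F b = n b.succ - n b.castSucc + β * d b)
    (hΦ : ∀ x, Φ x = -(ω₂ * n x) - lam * c x +
      (∑ b : Fin N, ((if (b : ℕ) = (x : ℕ) then F b else 0) - (if (b : ℕ) + 1 = (x : ℕ) then F b else 0))) -
      γ * ((if (x : ℕ) = 0 then 1 else 0) + (if (x : ℕ) = N then 1 else 0)) * m x) :
    (∑ x : Fin (N + 1), (m x * Φ x + ω₂ * (n x * m x))) +
        ∑ b : Fin N, (n b.succ - n b.castSucc) * (m b.succ - m b.castSucc) =
      -(γ * (m 0 ^ 2 + m (Fin.last N) ^ 2) +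
        (lam * ∑ x : Fin (N + 1), m x * c x + β * ∑ b : Fin N, d b * (m b.succ - m b.castSucc))) := by
  -- the bond double sum: each bond force acts on its two sites
  have key1 : ∑ x : Fin (N + 1), m x * (∑ b : Fin N, ((if (b : ℕ) = (x : ℕ) then F b else 0) -
      (if (b : ℕ) + 1 = (x : ℕ) then F b else 0))) = ∑ b : Fin N, (m b.castSucc - m b.succ) * F b := by
    simp only [Finset.mul_sum, mul_sub]
    rw [Finset.sum_comm]
    refine Finset.sum_congr rfl fun b _ => ?_
    rw [Finset.sum_sub_distrib, sum_mul_ite_val_eq_castSucc, sum_mul_ite_val_succ, sub_mul]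
  -- the bath friction hits sites `0` and `Fin.last N` (both at once when `N = 0`)
  have key2 : ∑ x : Fin (N + 1), m x * (γ * ((if (x : ℕ) = 0 then 1 else 0) +
      (if (x : ℕ) = N then 1 else 0)) * m x) = γ * (m 0 ^ 2 + m (Fin.last N) ^ 2) := by
    have e : ∀ x : Fin (N + 1), m x * (γ * ((if (x : ℕ) = 0 then 1 else 0) +
        (if (x : ℕ) = N then 1 else 0)) * m x) =
        γ * ((if (x : ℕ) = 0 then (1 : ℝ) else 0) * m x ^ 2) +
          γ * ((if (x : ℕ) = N then (1 : ℝ) else 0) * m x ^ 2) := by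
      intro x; ring
    rw [Finset.sum_congr rfl fun x _ => e x, Finset.sum_add_distrib, ← Finset.mul_sum, ← Finset.mul_sum,
      sum_ite_val_zero_mul, sum_ite_val_last_mul, mul_add]
  -- split the site sum
  have key3 : ∑ x : Fin (N + 1), (m x * Φ x + ω₂ * (n x * m x)) =
      ∑ x : Fin (N + 1), (-(lam * (m x * c x))) +
        ∑ x : Fin (N + 1), m x * (∑ b : Fin N, ((if (b : ℕ) = (x : ℕ) then F b else 0) -
          (if (b : ℕ) + 1 = (x : ℕ) then F b else 0))) -
        ∑ x : Fin (N + 1), m x * (γ * ((if (x : ℕ) = 0 then 1 else 0) +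
          (if (x : ℕ) = N then 1 else 0)) * m x) := by
    rw [← Finset.sum_add_distrib, ← Finset.sum_sub_distrib]
    exact Finset.sum_congr rfl fun x _ => by rw [hΦ x]; ring
  -- the harmonic bond forces telescope against the bond energies
  have key4 : ∑ b : Fin N, (m b.castSucc - m b.succ) * F b +
      ∑ b : Fin N, (n b.succ - n b.castSucc) * (m b.succ - m b.castSucc) =
      -(β * ∑ b : Fin N, d b * (m b.succ - m b.castSucc)) := by
    rw [← Finset.sum_add_distrib, Finset.mul_sum, ← Finset.sum_neg_distrib]
    exact Finset.sum_congr rfl fun b _ => by rw [hF b]; ring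
  have key5 : ∑ x : Fin (N + 1), (-(lam * (m x * c x))) = -(lam * ∑ x : Fin (N + 1), m x * c x) := by
    rw [Finset.mul_sum, ← Finset.sum_neg_distrib]
  rw [key3, key1, key2, key5]
  linear_combination key4

end Algebra

/-! ## Small analytic helpers -/

/-- `t ↦ [p] f t` (a time-independent switch) is continuous when `f` is. [folklore] -/
theorem continuous_ite_const {p : Prop} [Decidable p] {f : ℝ → ℝ} (hf : Continuous f) :
    Continuous fun s => if p then f s else 0 := by
  by_cases hp : p
  · simp only [if_pos hp]; exact hf
  · simp only [if_neg hp]; exact continuous_const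

/-! ## The total energy balance -/

/-- **Total energy balance of the mean field** (`CoherentEnergyBalance` of the idea card
`coherent-field-beer-lambert`, fixed `N`). At one admissible parameter point and one `N`, the Duhamel equations of
the coherent response field and its regularity/decay package imply

`γ (∫₀^∞ m_0² + ∫₀^∞ m_N²) + (lam Σ_x ∫₀^∞ m_x c_x + β Σ_b ∫₀^∞ d_b (m_{b+1} - m_b)) = T²/2`:

the kick energy `T²/2` of the mean field is entirely dissipated into the two baths (`γ ∫ m_0²`, `γ ∫ m_N²`) or
absorbed by the mean anharmonic polarisation. Proof: FTC for the total harmonic energy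
`E = ½Σ_x(m_x² + ω₂ n_x²) + ½Σ_b(n_{b+1} - n_b)²` on `(0,∞)` with `E(0) = T²/2`, `E(∞) = 0` and the derivative
identity `energyDeriv_eq`. [folklore] -/
theorem totalBalance_of_meanField : ∀ ω₂ lam β γ : ℝ, 0 < ω₂ → 0 < lam → 0 < β → 0 < γ → ∀ T : ℝ, 0 < T →
    ∀ N : ℕ, ((∀ (x : Fin (N + 1)) (t : ℝ), 0 ≤ t → posResp ω₂ lam β γ T N x t =
      ∫ s in (0 : ℝ)..t, momResp ω₂ lam β γ T N x s) ∧ (∀ (x : Fin (N + 1)) (t : ℝ), 0 ≤ t →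
      momResp ω₂ lam β γ T N x t = (if (x : ℕ) = 0 then T else 0) + ∫ s in (0 : ℝ)..t,
        (-(ω₂ * posResp ω₂ lam β γ T N x s) - lam * cubeResp ω₂ lam β γ T N x s +
          (∑ b : Fin N, ((if (b : ℕ) = (x : ℕ) then bondForceResp ω₂ lam β γ T N b s else 0) -
            (if (b : ℕ) + 1 = (x : ℕ) then bondForceResp ω₂ lam β γ T N b s else 0))) -
          γ * ((if (x : ℕ) = 0 then 1 else 0) + (if (x : ℕ) = N then 1 else 0)) *
            momResp ω₂ lam β γ T N x s))) →
    ((∀ x : Fin (N + 1), Continuous (momResp ω₂ lam β γ T N x) ∧ Continuous (posResp ω₂ lam β γ T N x) ∧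
        Continuous (cubeResp ω₂ lam β γ T N x)) ∧
      (∀ b : Fin N, Continuous (stretchCubeResp ω₂ lam β γ T N b)) ∧
      (∀ (b : Fin N) (t : ℝ), bondForceResp ω₂ lam β γ T N b t =
        posResp ω₂ lam β γ T N b.succ t - posResp ω₂ lam β γ T N b.castSucc t +
          β * stretchCubeResp ω₂ lam β γ T N b t) ∧
      (∃ C c : ℝ, 0 < c ∧ ∀ t : ℝ, 0 ≤ t →
        (∀ x : Fin (N + 1), |momResp ω₂ lam β γ T N x t| ≤ C * Real.exp (-c * t) ∧
            |posResp ω₂ lam β γ T N x t| ≤ C * Real.exp (-c * t) ∧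
            |cubeResp ω₂ lam β γ T N x t| ≤ C * Real.exp (-c * t)) ∧
        (∀ b : Fin N, |stretchCubeResp ω₂ lam β γ T N b t| ≤ C * Real.exp (-c * t)))) →
    γ * ((∫ t in Ioi (0 : ℝ), momResp ω₂ lam β γ T N 0 t ^ 2) +
        ∫ t in Ioi (0 : ℝ), momResp ω₂ lam β γ T N (Fin.last N) t ^ 2) +
      (lam * (∑ x : Fin (N + 1), ∫ t in Ioi (0 : ℝ), momResp ω₂ lam β γ T N x t * cubeResp ω₂ lam β γ T N x t) +
        β * ∑ b : Fin N, ∫ t in Ioi (0 : ℝ), stretchCubeResp ω₂ lam β γ T N b t *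
          (momResp ω₂ lam β γ T N b.succ t - momResp ω₂ lam β γ T N b.castSucc t)) = T ^ 2 / 2 := by
  intro ω₂ lam β γ _ _ _ _ T _ N hDuh hReg
  obtain ⟨hpos, hmom⟩ := hDuh
  obtain ⟨hc1, hdc, hF, C, c, hc, hbd⟩ := hReg
  -- abbreviations
  set m : Fin (N + 1) → ℝ → ℝ := momResp ω₂ lam β γ T N
  set n : Fin (N + 1) → ℝ → ℝ := posResp ω₂ lam β γ T N
  set cc : Fin (N + 1) → ℝ → ℝ := cubeResp ω₂ lam β γ T N
  set d : Fin N → ℝ → ℝ := stretchCubeResp ω₂ lam β γ T N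
  set F : Fin N → ℝ → ℝ := bondForceResp ω₂ lam β γ T N
  have hmc : ∀ x, Continuous (m x) := fun x => (hc1 x).1
  have hnc : ∀ x, Continuous (n x) := fun x => (hc1 x).2.1
  have hccc : ∀ x, Continuous (cc x) := fun x => (hc1 x).2.2
  have hFc : ∀ b, Continuous (F b) := by
    intro b
    have e : F b = fun t => n b.succ t - n b.castSucc t + β * d b t := funext (hF b)
    rw [e]
    exact ((hnc b.succ).fun_sub (hnc b.castSucc)).fun_add (continuous_const.fun_mul (hdc b))
  -- the mean-field drift
  set Φ : Fin (N + 1) → ℝ → ℝ := fun x s => -(ω₂ * n x s) - lam * cc x s +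
      (∑ b : Fin N, ((if (b : ℕ) = (x : ℕ) then F b s else 0) - (if (b : ℕ) + 1 = (x : ℕ) then F b s else 0))) -
      γ * ((if (x : ℕ) = 0 then 1 else 0) + (if (x : ℕ) = N then 1 else 0)) * m x s
  have hΦc : ∀ x, Continuous (Φ x) := by
    intro x
    have hB : Continuous fun s => ∑ b : Fin N, ((if (b : ℕ) = (x : ℕ) then F b s else 0) -
        (if (b : ℕ) + 1 = (x : ℕ) then F b s else 0)) :=
      continuous_finsetSum _ fun b _ => (continuous_ite_const (hFc b)).fun_sub (continuous_ite_const (hFc b))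
    exact (((continuous_const.fun_mul (hnc x)).fun_neg.fun_sub (continuous_const.fun_mul (hccc x))).fun_add
      hB).fun_sub (continuous_const.fun_mul (hmc x))
  -- FTC-1: derivatives on `(0, ∞)`
  have hnD : ∀ (x : Fin (N + 1)) (t : ℝ), 0 < t → HasDerivAt (n x) (m x t) t := by
    intro x t ht
    have h1 : HasDerivAt (fun u => ∫ s in (0 : ℝ)..u, m x s) (m x t) t :=
      intervalIntegral.integral_hasDerivAt_right ((hmc x).intervalIntegrable _ _)
        ((hmc x).stronglyMeasurableAtFilter _ _) (hmc x).continuousAt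
    refine h1.congr_of_eventuallyEq ?_
    filter_upwards [Ioi_mem_nhds ht] with u hu
    exact hpos x u (le_of_lt hu)
  have hmD : ∀ (x : Fin (N + 1)) (t : ℝ), 0 < t → HasDerivAt (m x) (Φ x t) t := by
    intro x t ht
    have h1 : HasDerivAt (fun u => (if (x : ℕ) = 0 then T else 0) + ∫ s in (0 : ℝ)..u, Φ x s) (Φ x t) t :=
      (intervalIntegral.integral_hasDerivAt_right ((hΦc x).intervalIntegrable _ _)
        ((hΦc x).stronglyMeasurableAtFilter _ _) (hΦc x).continuousAt).const_add _
    refine h1.congr_of_eventuallyEq ?_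
    filter_upwards [Ioi_mem_nhds ht] with u hu
    exact hmom x u (le_of_lt hu)
  -- twice the total harmonic energy, and the dissipation density
  set E : ℝ → ℝ := fun t => (∑ x : Fin (N + 1), (m x t * m x t + ω₂ * (n x t * n x t))) +
      ∑ b : Fin N, (n b.succ t - n b.castSucc t) * (n b.succ t - n b.castSucc t) with hE_def
  set G : ℝ → ℝ := fun t => γ * (m 0 t ^ 2 + m (Fin.last N) t ^ 2) +
      (lam * ∑ x : Fin (N + 1), m x t * cc x t + β * ∑ b : Fin N, d b t * (m b.succ t - m b.castSucc t))
    with hG_def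
  have hEc : Continuous E :=
    (continuous_finsetSum _ fun (x : Fin (N + 1)) _ => ((hmc x).fun_mul (hmc x)).fun_add
      (continuous_const.fun_mul ((hnc x).fun_mul (hnc x)))).fun_add
      (continuous_finsetSum _ fun (b : Fin N) _ =>
        ((hnc b.succ).fun_sub (hnc b.castSucc)).fun_mul ((hnc b.succ).fun_sub (hnc b.castSucc)))
  have hED : ∀ t ∈ Ioi (0 : ℝ), HasDerivAt E (-(2 * G t)) t := by
    intro t ht
    have ht' : 0 < t := ht
    have h1 : HasDerivAt E ((∑ x : Fin (N + 1), (Φ x t * m x t + m x t * Φ x t +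
        ω₂ * (m x t * n x t + n x t * m x t))) +
        ∑ b : Fin N, ((m b.succ t - m b.castSucc t) * (n b.succ t - n b.castSucc t) +
          (n b.succ t - n b.castSucc t) * (m b.succ t - m b.castSucc t))) t := by
      refine HasDerivAt.fun_add (HasDerivAt.fun_sum fun x _ => ?_) (HasDerivAt.fun_sum fun b _ => ?_)
      · exact ((hmD x t ht').fun_mul (hmD x t ht')).fun_add
          (((hnD x t ht').fun_mul (hnD x t ht')).const_mul ω₂)
      · exact ((hnD b.succ t ht').fun_sub (hnD b.castSucc t ht')).fun_mul
          ((hnD b.succ t ht').fun_sub (hnD b.castSucc t ht'))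
    refine h1.congr_deriv ?_
    have key := energyDeriv_eq ω₂ lam β γ (fun x => m x t) (fun x => n x t) (fun x => cc x t) (fun x => Φ x t)
      (fun b => d b t) (fun b => F b t) (fun b => hF b t) (fun x => rfl)
    have e2 : (∑ x : Fin (N + 1), (Φ x t * m x t + m x t * Φ x t + ω₂ * (m x t * n x t + n x t * m x t))) +
        ∑ b : Fin N, ((m b.succ t - m b.castSucc t) * (n b.succ t - n b.castSucc t) +
          (n b.succ t - n b.castSucc t) * (m b.succ t - m b.castSucc t)) =
        2 * ((∑ x : Fin (N + 1), (m x t * Φ x t + ω₂ * (n x t * m x t))) +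
          ∑ b : Fin N, (n b.succ t - n b.castSucc t) * (m b.succ t - m b.castSucc t)) := by
      rw [mul_add, Finset.mul_sum, Finset.mul_sum]
      congr 1
      · exact Finset.sum_congr rfl fun x _ => by ring
      · exact Finset.sum_congr rfl fun b _ => by ring
    rw [e2, hG_def]
    linear_combination (2 : ℝ) * key
  -- decay: every response tends to `0`, hence so does `E`
  have hm0 : ∀ x, Tendsto (m x) atTop (𝓝 0) := fun x =>
    RightBalance.tendsto_zero_of_abs_le_exp hc fun t ht => ((hbd t ht).1 x).1
  have hn0 : ∀ x, Tendsto (n x) atTop (𝓝 0) := fun x =>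
    RightBalance.tendsto_zero_of_abs_le_exp hc fun t ht => ((hbd t ht).1 x).2.1
  have hElim : Tendsto E atTop (𝓝 0) := by
    have h := (tendsto_finsetSum (Finset.univ : Finset (Fin (N + 1))) fun x _ =>
        ((hm0 x).mul (hm0 x)).add (((hn0 x).mul (hn0 x)).const_mul ω₂)).add
      (tendsto_finsetSum (Finset.univ : Finset (Fin N)) fun b _ =>
        ((hn0 b.succ).sub (hn0 b.castSucc)).mul ((hn0 b.succ).sub (hn0 b.castSucc)))
    have h0 : (∑ x : Fin (N + 1), ((0 : ℝ) * 0 + ω₂ * (0 * 0))) + ∑ b : Fin N, ((0 : ℝ) - 0) * (0 - 0) = 0 := by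
      simp
    rw [h0] at h
    exact h
  -- integrability of the dissipation density on `(0, ∞)`
  have hprod : ∀ {f g : ℝ → ℝ}, Continuous f → Continuous g →
      (∀ t, 0 ≤ t → |f t| ≤ C * Real.exp (-c * t)) → (∀ t, 0 ≤ t → |g t| ≤ C * Real.exp (-c * t)) →
      IntegrableOn (fun t => f t * g t) (Ioi 0) := fun hf hg hbf hbg =>
    RightBalance.integrableOn_Ioi_of_abs_le_exp hc (hf.fun_mul hg)
      fun t ht => RightBalance.abs_mul_le_of_abs_le_exp hc ht (hbf t ht) (hbg t ht)
  have hbm : ∀ (x : Fin (N + 1)) (t : ℝ), 0 ≤ t → |m x t| ≤ C * Real.exp (-c * t) :=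
    fun x t ht => ((hbd t ht).1 x).1
  have hbc : ∀ (x : Fin (N + 1)) (t : ℝ), 0 ≤ t → |cc x t| ≤ C * Real.exp (-c * t) :=
    fun x t ht => ((hbd t ht).1 x).2.2
  have hbd' : ∀ (b : Fin N) (t : ℝ), 0 ≤ t → |d b t| ≤ C * Real.exp (-c * t) := fun b t ht => (hbd t ht).2 b
  have hI1 : ∀ x, IntegrableOn (fun t => m x t ^ 2) (Ioi 0) := by
    intro x
    have := hprod (hmc x) (hmc x) (hbm x) (hbm x)
    simpa [sq] using this
  have hI2 : ∀ x, IntegrableOn (fun t => m x t * cc x t) (Ioi 0) := fun x =>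
    hprod (hmc x) (hccc x) (hbm x) (hbc x)
  have hI3 : ∀ b, IntegrableOn (fun t => d b t * (m b.succ t - m b.castSucc t)) (Ioi 0) := by
    intro b
    have h1 := hprod (hdc b) (hmc b.succ) (hbd' b) (hbm b.succ)
    have h2 := hprod (hdc b) (hmc b.castSucc) (hbd' b) (hbm b.castSucc)
    exact IntegrableOn.congr_fun (h1.sub' h2) (fun t _ => by simp only [mul_sub]) measurableSet_Ioi
  have hIsum1 : IntegrableOn (fun t => ∑ x : Fin (N + 1), m x t * cc x t) (Ioi 0) :=
    integrable_finsetSum _ fun x _ => hI2 x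
  have hIsum2 : IntegrableOn (fun t => ∑ b : Fin N, d b t * (m b.succ t - m b.castSucc t)) (Ioi 0) :=
    integrable_finsetSum _ fun b _ => hI3 b
  have hGI : IntegrableOn G (Ioi 0) :=
    (((hI1 0).fun_add (hI1 (Fin.last N))).const_mul γ).fun_add
      ((hIsum1.const_mul lam).fun_add (hIsum2.const_mul β))
  -- the energy at time `0`: the kick
  have hE0 : E 0 = T ^ 2 := by
    have hm0' : ∀ x, m x 0 = if (x : ℕ) = 0 then T else 0 := fun x => by
      rw [hmom x 0 le_rfl, intervalIntegral.integral_same, add_zero]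
    have hn0' : ∀ x, n x 0 = 0 := fun x => by rw [hpos x 0 le_rfl, intervalIntegral.integral_same]
    simp only [hE_def, hm0', hn0', sub_self, mul_zero, add_zero, Finset.sum_const_zero]
    rw [Finset.sum_eq_single 0]
    · simp [sq]
    · intro x _ hx
      have h : (x : ℕ) ≠ 0 := fun h => hx (Fin.ext h)
      simp [h]
    · exact fun h => absurd (Finset.mem_univ _) h
  -- FTC-2 on `(0, ∞)`
  have hFTC := integral_Ioi_of_hasDerivAt_of_tendsto hEc.continuousWithinAt hED ((hGI.const_mul 2).fun_neg) hElim
  have hInt : ∫ t in Ioi (0 : ℝ), G t = T ^ 2 / 2 := by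
    have h2 : ∫ t in Ioi (0 : ℝ), -(2 * G t) = -(2 * ∫ t in Ioi (0 : ℝ), G t) := by
      rw [integral_neg, integral_const_mul]
    rw [h2, hE0] at hFTC
    linarith
  -- split the integral of the dissipation density
  have hsplit : ∫ t in Ioi (0 : ℝ), G t =
      γ * ((∫ t in Ioi (0 : ℝ), m 0 t ^ 2) + ∫ t in Ioi (0 : ℝ), m (Fin.last N) t ^ 2) +
        (lam * (∑ x : Fin (N + 1), ∫ t in Ioi (0 : ℝ), m x t * cc x t) +
          β * ∑ b : Fin N, ∫ t in Ioi (0 : ℝ), d b t * (m b.succ t - m b.castSucc t)) := by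
    simp only [hG_def]
    rw [integral_add (((hI1 0).fun_add (hI1 (Fin.last N))).const_mul γ)
        ((hIsum1.const_mul lam).fun_add (hIsum2.const_mul β)),
      integral_const_mul, integral_add (hI1 0) (hI1 (Fin.last N)),
      integral_add (hIsum1.const_mul lam) (hIsum2.const_mul β), integral_const_mul, integral_const_mul,
      integral_finsetSum _ (fun x _ => hI2 x), integral_finsetSum _ (fun b _ => hI3 b)]
  rw [hsplit] at hInt
  exact hInt

end Summit.AtomisticToContinuum.FouriersLaw.Theorems.CoherentDephasing.TotalBalance

end
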